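import Literature.NumberTheory.EllipticCurves.BDKim2013.NoProperFiniteIndexSubmodule
import Literature.NumberTheory.EllipticCurves.Kobayashi2003.SignedSelmerDualExistsProofs
import Literature.NumberTheory.EllipticCurves.IwasawaEulerCharDualityProofs
import HarnessLib

/-!
# B. D. Kim 2013, Thm. 3.14: the PRINTED form («`Sel^±_p(E/F_∞)` has no proper `Λ`-submodule of finite
# index») IMPLIES the typed Pontryagin-dual form (`thm314_signedSelmerDual_noFiniteSubmodule`: «`X^±` has no
# nonzero finite `Λ`-submodule») — faithfulness of the transcription, in the kernel

`Proofs` file (theorems only: no definition, no named fact; axioms standard) next to the statement file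
`BDKim2013/NoProperFiniteIndexSubmodule.lean` (p610386). Byoung Du Kim, J. Aust. Math. Soc. **95** (2013),
Thm. 3.14 (p. 198) is printed for the discrete module `S = Sel^±_p(E/F_∞)`: "`Sel^±_p(E/F_∞)` has no proper
`Λ`-submodule of finite index"; the tree's named fact types it on the Pontryagin dual `X^± = D.X` of a datum
`D : Kobayashi2003.SignedSelmerDualData W κ γ ε` ("every finite `Λ`-submodule of `X^±` is `⊥`", the currency
of `KitajimaOtsuki2018.mainThm13_…` and of `SignedEC.natCard_signedEndCoinvariants_eq_one_iff_forall_finite_eq_bot`).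
THIS FILE PROVES, for every number field `K`, `ℤ_p`-extension `κ`, element `γ`, sign `ε` and datum `D`, that
the printed reading implies the typed one:

* `forall_finite_submodule_eq_bot_of_forall_finiteIndex_eq_top` — if every `conj_γ`-stable subgroup
  `S' ≤ Sel^ε(E/K_∞)` of finite index is all of `Sel^ε(E/K_∞)` (a `Λ = ℤ_p[[T]]`-submodule of the discrete
  `p`-primary `S`, `T = γ − 1` acting as `conj_γ − 1`, is exactly a `conj_γ`-stable subgroup), then every
  finite `Λ`-submodule `N ≤ X^ε` is `⊥`. Proof: the annihilator `S' = N^⊥ = {s | ∀ x ∈ N, x(s) = 0}` is the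
  kernel of `s ↦ (x ↦ x(s)) : S → Hom(N, ℚ/ℤ)`, a finite group (`PontryaginCard.finite_characterModule_of_finite`),
  so `S'` has finite index; it is `conj_γ`-stable because `x(conj_γ s) = x(s) + (T·x)(s)`
  (`SignedSelmerDualData.toDual_T_smul`) and `T·N ⊆ N`; hence `S' = S`, every `x ∈ N` has `x(s) = 0` for all
  `s`, and `x = 0` (`toDual` is injective).
* `thm314_signedSelmerDual_noFiniteSubmodule_of_printed` — consequently the named fact follows from Kim's
  statement READ VERBATIM on `Sel^ε(E/ℚ_∞)` (same binders; displayed as a hypothesis, not re-declared).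

So assuming the typed fact assumes NO MORE than Kim's printed theorem. (The converse — typed ⇒ printed —
is the same duality read backwards, `(S/S')^∨ ↪ X^ε` finite; not formalised here.) HONEST FRAMING
(LADDER-BSD D-0154 (2) INPUTS row F10, seat `bsd-inputs-kim315-p1`): a faithfulness lemma about a
transcription; nothing about any curve is asserted; no `_holds`; BSD is not proved by any of this.

References: [BDKim2013] Thm. 3.14 (p. 198), Thm. 1.1 (p. 190); [GreenbergLNM1716] §4 p. 104 (the same
duality for `Sel_E(F_∞)_p`: "no proper `Λ`-submodules of finite index" ↔ finite submodules of the dual);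
[KitajimaOtsuki2018] Main Thm. 1.3 (the dual phrasing).
-/

noncomputable section

open scoped Classical

universe u

namespace Literature.NumberTheory.EllipticCurves.BDKim2013

open Literature.NumberTheory.EllipticCurves Literature.NumberTheory.EllipticCurves.Kobayashi2003
  WeierstrassCurve ZpExtension

section General

variable {K : Type u} [Field K] [NumberField K] {W : WeierstrassCurve K} {p : ℕ} [Fact p.Prime]
  {κ : ZpExtension K p} {γ : Field.absoluteGaloisGroup K} {ε : ℤˣ}

/-- **Printed Thm. 3.14 ⟹ typed Thm. 3.14**, for every number field `K`, `ℤ_p`-extension `κ`, `γ ∈ Γ_K`,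
sign `ε` and Pontryagin-dual datum `D` of `Sel^ε(E/K_∞)`: if every `conj_γ`-stable subgroup of finite index
of `Sel^ε(E/K_∞)` is the whole group («no proper `Λ`-submodule of finite index», `Λ = ℤ_p[[γ − 1]]`), then
every finite `Λ`-submodule of `X^ε = D.X` is trivial. The annihilator `N^⊥` of a finite submodule `N` is the
kernel of `S → Hom(N, ℚ/ℤ)`, `s ↦ (x ↦ x(s))` (finite target, so finite index), and is `conj_γ`-stable by
`x(conj_γ s) = x(s) + (T·x)(s)` with `T·N ⊆ N`; so `N^⊥ = S`, i.e. `N ⊆ ker toDual = 0`.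
[cite: BDKim2013, Thm. 3.14 (p. 198)] [cite: GreenbergLNM1716, §4 p. 104] -/
theorem forall_finite_submodule_eq_bot_of_forall_finiteIndex_eq_top (D : SignedSelmerDualData W κ γ ε)
    (h : ∀ S' : AddSubgroup (signedSelmerInfty W κ ε),
      (∀ s ∈ S', conjSignedSelmerInfty W κ ε γ s ∈ S') → S'.FiniteIndex → S' = ⊤) :
    ∀ N : Submodule (IwasawaAlgebra p) D.X, Finite N → N = ⊥ := by
  intro N hN
  -- `φ : S → Hom(N, ℚ/ℤ)`, `s ↦ (x ↦ x(s))`; its kernel is the annihilator `N^⊥`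
  let φ : signedSelmerInfty W κ ε →+ CharacterModule N :=
    { toFun := fun s ↦
        { toFun := fun x ↦ D.toDual (x : D.X) s
          map_zero' := by
            rw [Submodule.coe_zero, map_zero, AddMonoidHom.zero_apply]
          map_add' := fun x y ↦ by
            rw [Submodule.coe_add, map_add, AddMonoidHom.add_apply] }
      map_zero' := by
        ext x
        exact map_zero (D.toDual (x : D.X))
      map_add' := fun s t ↦ by
        ext x
        exact map_add (D.toDual (x : D.X)) s t }
  have hφ : ∀ (s : signedSelmerInfty W κ ε) (x : N), φ s x = D.toDual (x : D.X) s := fun _ _ ↦ rfl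
  have hker : ∀ s : signedSelmerInfty W κ ε, s ∈ φ.ker ↔ ∀ x ∈ N, D.toDual x s = 0 := by
    intro s
    rw [AddMonoidHom.mem_ker]
    constructor
    · intro hs x hx
      have := DFunLike.congr_fun hs ⟨x, hx⟩
      rwa [hφ] at this
    · intro hs
      ext x
      rw [hφ]
      exact hs x x.2
  -- `N^⊥` has finite index: `S/N^⊥ ≃ range φ ⊆ Hom(N, ℚ/ℤ)`, finite
  haveI : Finite (CharacterModule N) := PontryaginCard.finite_characterModule_of_finite N
  haveI : Finite (signedSelmerInfty W κ ε ⧸ φ.ker) :=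
    Finite.of_equiv _ (QuotientAddGroup.quotientKerEquivRange φ).toEquiv.symm
  have hfi : φ.ker.FiniteIndex := AddSubgroup.finiteIndex_of_finite_quotient
  -- `N^⊥` is `conj_γ`-stable: `x(conj_γ s) = x(s) + (T·x)(s)` and `T·x ∈ N`
  have hstab : ∀ s ∈ φ.ker, conjSignedSelmerInfty W κ ε γ s ∈ φ.ker := by
    intro s hs
    rw [hker] at hs ⊢
    intro x hx
    have hT := D.toDual_T_smul x s
    rw [hs _ (N.smul_mem (PowerSeries.X : IwasawaAlgebra p) hx), hs x hx, sub_zero] at hT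
    have hconj : conjSignedSelmerInfty W κ ε γ s =
        ⟨W.conjH1 p κ.kerSubgroup γ s, D.conj_mem s s.2⟩ := Subtype.ext rfl
    rw [hconj]
    exact hT.symm
  -- hence `N^⊥ = S`, so every `x ∈ N` is killed by `toDual`, hence is `0`
  have htop := h φ.ker hstab hfi
  refine (Submodule.eq_bot_iff N).mpr fun x hx ↦ ?_
  have hx0 : D.toDual x = 0 := by
    ext s
    have hs : s ∈ φ.ker := by rw [htop]; exact AddSubgroup.mem_top s
    exact ((hker s).mp hs) x hx
  exact D.bijective.1 (by rw [hx0, map_zero])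

/-- **Typed Thm. 3.14 ⟹ printed Thm. 3.14** (the converse reading): if every finite `Λ`-submodule of
`X^ε = D.X` is trivial, then every `conj_γ`-stable subgroup `S'` of finite index of `Sel^ε(E/K_∞)` is the
whole group. The annihilator `N = (S/S')^⊥ = {x | x(S') = 0}` is a `Λ`-submodule (for `f ∈ Λ`,
`(f·x)(s) = ∑ coeff_i(f) · x(ψ^i s)` with `ψ = conj_γ − 1` preserving `S'`: `SignedSelmerDualData.toDual_smul`,
`IwasawaDual.evalT_congr`), finite (it embeds into `Hom(S/S', ℚ/ℤ)`), hence `0`; but a proper `S'` has a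
non-zero character of `S/S'` (Mathlib `CharacterModule.exists_character_apply_ne_zero_of_ne_zero`), which
`toDual` (onto) realises as a non-zero element of `N` — contradiction. Together with the previous theorem:
the two readings are EQUIVALENT, datum by datum. [cite: BDKim2013, Thm. 3.14 (p. 198)] [cite: GreenbergLNM1716, §4 p. 104] -/
theorem forall_finiteIndex_eq_top_of_forall_finite_submodule_eq_bot (D : SignedSelmerDualData W κ γ ε)
    (h : ∀ N : Submodule (IwasawaAlgebra p) D.X, Finite N → N = ⊥) :
    ∀ S' : AddSubgroup (signedSelmerInfty W κ ε),
      (∀ s ∈ S', conjSignedSelmerInfty W κ ε γ s ∈ S') → S'.FiniteIndex → S' = ⊤ := by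
  intro S' hstab hfi
  set hL := isLocNil_conjSignedSelmerInfty_sub_one' W κ ε γ with hLdef
  -- `S'` is stable under every power of `ψ = conj_γ − 1`
  have hψ : ∀ i : ℕ, ∀ s ∈ S', ((conjSignedSelmerInfty W κ ε γ - 1) ^ i) s ∈ S' := by
    intro i
    induction i with
    | zero => intro s hs; simpa using hs
    | succ i ih =>
      intro s hs
      rw [pow_succ, AddMonoid.End.coe_mul, Function.comp_apply]
      refine ih _ ?_
      rw [IwasawaDual.End_sub_apply, AddMonoid.End.one_apply]
      exact S'.sub_mem (hstab s hs) hs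
  -- the annihilator `N = {x | x(S') = 0}`, a `Λ`-submodule of `X^ε`
  let N : Submodule (IwasawaAlgebra p) D.X :=
    { carrier := {x | ∀ s ∈ S', D.toDual x s = 0}
      zero_mem' := fun s _ ↦ by rw [map_zero, AddMonoidHom.zero_apply]
      add_mem' := fun {x y} hx hy s hs ↦ by
        rw [map_add, AddMonoidHom.add_apply, hx s hs, hy s hs, add_zero]
      smul_mem' := fun f x hx s hs ↦ by
        change D.toDual (f • x) s = 0
        rw [D.toDual_smul f x, hL.smulFun_apply f (D.toDual x) (hL.tN_spec s) (hL.tk_spec s),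
          IwasawaDual.evalT_congr f (y := (0 : signedSelmerInfty W κ ε →+ AddCircle (1 : ℚ)))
            (fun i _ ↦ by rw [AddMonoidHom.zero_apply]; exact hx _ (hψ i s hs)),
          IwasawaDual.evalT_def]
        exact Finset.sum_eq_zero fun i _ ↦ by
          rw [AddMonoidHom.zero_apply, IwasawaDual.zpT_zero_right] }
  have hNmem : ∀ x : D.X, x ∈ N ↔ ∀ s ∈ S', D.toDual x s = 0 := fun _ ↦ Iff.rfl
  -- `N` is finite: `x ↦ (s mod S' ↦ x(s))` embeds it into `Hom(S/S', ℚ/ℤ)`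
  haveI : Finite (signedSelmerInfty W κ ε ⧸ S') := AddSubgroup.finite_quotient_of_finiteIndex
  haveI : Finite (signedSelmerInfty W κ ε ⧸ S' →+ AddCircle (1 : ℚ)) :=
    PontryaginCard.finite_characterModule_of_finite (signedSelmerInfty W κ ε ⧸ S')
  have hle : ∀ x : N, S' ≤ (D.toDual (x : D.X)).ker := fun x s hs ↦
    (AddMonoidHom.mem_ker).mpr ((hNmem x).mp x.2 s hs)
  have hNfin : Finite N := by
    refine Finite.of_injective
      (fun x : N ↦ (QuotientAddGroup.lift S' (D.toDual (x : D.X)) (hle x) :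
        signedSelmerInfty W κ ε ⧸ S' →+ AddCircle (1 : ℚ))) fun x y hxy ↦ ?_
    apply Subtype.ext
    apply D.bijective.1
    ext s
    have := DFunLike.congr_fun hxy (s : signedSelmerInfty W κ ε ⧸ S')
    simpa only [QuotientAddGroup.lift_mk] using this
  have hbot : N = ⊥ := h N hNfin
  -- a proper `S'` would give a non-zero character of `S/S'`, realised by `toDual` inside `N`
  rw [eq_top_iff]
  intro s₀ _
  by_contra hs₀
  have hne : ((s₀ : signedSelmerInfty W κ ε) : signedSelmerInfty W κ ε ⧸ S') ≠ 0 := by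
    rwa [Ne, QuotientAddGroup.eq_zero_iff]
  obtain ⟨χ, hχ⟩ := CharacterModule.exists_character_apply_ne_zero_of_ne_zero hne
  obtain ⟨x, hx⟩ := D.bijective.2 (χ.comp (QuotientAddGroup.mk' S'))
  have hxN : x ∈ N := by
    rw [hNmem]
    intro s hs
    rw [hx, AddMonoidHom.comp_apply, QuotientAddGroup.mk'_apply,
      (QuotientAddGroup.eq_zero_iff s).mpr hs, map_zero]
  have hx0 : x = 0 := by
    rw [hbot] at hxN
    exact (Submodule.mem_bot (R := IwasawaAlgebra p)).mp hxN
  apply hχ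
  have := DFunLike.congr_fun hx s₀
  rw [hx0, map_zero, AddMonoidHom.zero_apply, AddMonoidHom.comp_apply,
    QuotientAddGroup.mk'_apply] at this
  exact this.symm

/-- **The two readings of Kim's Thm. 3.14 are equivalent** for every Pontryagin-dual datum: «every
`conj_γ`-stable finite-index subgroup of `Sel^ε(E/K_∞)` is everything» ↔ «every finite `Λ`-submodule of
`X^ε` is `⊥`». [cite: BDKim2013, Thm. 3.14 (p. 198)] [cite: GreenbergLNM1716, §4 p. 104] -/
theorem forall_finiteIndex_eq_top_iff_forall_finite_submodule_eq_bot (D : SignedSelmerDualData W κ γ ε) :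
    (∀ S' : AddSubgroup (signedSelmerInfty W κ ε),
      (∀ s ∈ S', conjSignedSelmerInfty W κ ε γ s ∈ S') → S'.FiniteIndex → S' = ⊤) ↔
    ∀ N : Submodule (IwasawaAlgebra p) D.X, Finite N → N = ⊥ :=
  ⟨forall_finite_submodule_eq_bot_of_forall_finiteIndex_eq_top D,
    forall_finiteIndex_eq_top_of_forall_finite_submodule_eq_bot D⟩

end General

/-- **The named fact `thm314_signedSelmerDual_noFiniteSubmodule` follows from Kim's Thm. 3.14 READ VERBATIM
on `Sel^±_p(E/ℚ_∞)`** — "Assume that `Sel^±_p(E/F_∞)` is `Λ`-cotorsion. Then `Sel^±_p(E/F_∞)` has no proper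
`Λ`-submodule of finite index" (p. 198), transcribed with the fact's own binders (`F = ℚ`, `p ≠ 2` good with
`a_p = 0`, `κ` cyclotomic with topological generator `γ`, sign `ε`, the cotorsion witnessed on a
Pontryagin-dual datum `D`) and the conclusion on `S = Kobayashi2003.signedSelmerInfty W κ ε` itself: every
`conj_γ`-stable subgroup of finite index of `S` (= `Λ`-submodule of finite index, `Λ = ℤ_p[[γ − 1]]`) is
`⊤`. Hence the tree's dual-form fact assumes no more than print. The printed form is displayed as a
hypothesis, NOT re-declared as a second fact. [cite: BDKim2013, Thm. 3.14 (p. 198) and Thm. 1.1 (p. 190)] -/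
theorem thm314_signedSelmerDual_noFiniteSubmodule_of_printed
    (h : ∀ (W : WeierstrassCurve ℚ) [W.IsElliptic] [W.IsGloballyMinimal] (p : ℕ) [Fact p.Prime],
      p ≠ 2 → W.HasGoodReductionAtPrime p → W.frobeniusTrace p = 0 →
      ∀ (κ : ZpExtension ℚ p) (γ : Field.absoluteGaloisGroup ℚ), κ.IsCyclotomic → κ.IsTopGenerator γ →
      ∀ (ε : ℤˣ) (D : SignedSelmerDualData W κ γ ε) [Module.Finite (IwasawaAlgebra p) D.X],
        Module.IsTorsion (IwasawaAlgebra p) D.X →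
        ∀ S' : AddSubgroup (signedSelmerInfty W κ ε),
          (∀ s ∈ S', conjSignedSelmerInfty W κ ε γ s ∈ S') → S'.FiniteIndex → S' = ⊤) :
    thm314_signedSelmerDual_noFiniteSubmodule := by
  intro W _ _ p _ hp2 hgood hap κ γ hκ hγ ε D _ hX
  exact forall_finite_submodule_eq_bot_of_forall_finiteIndex_eq_top D
    (h W p hp2 hgood hap κ γ hκ hγ ε D hX)

end Literature.NumberTheory.EllipticCurves.BDKim2013

end
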